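import Summits.CriticalPhenomena.SAWScalingLimit.Theorems.SAWCircleScreeningScreeningRecursionGeomC
import Literature.Probability.LatticeModels.MeshDomainBigComponents
import HarnessLib

/-!
# Screening recursion for `SAWCircleScreening`, part VI: the bulk survives the near data

Route `SAWCircleScreening` of `CriticalPhenomena/SAWScalingLimit`, support item
`ScreeningRecursion` (stmt-CriticalPhenomena-5468). The discrete domain `Ω_δ = meshDomain Ω δ`
is the union of the LARGEST components of the mesh graph; the multi-scale coupling conditions
the critical SAW on its initial segment, which amounts to removing near data `K ⊆ B̄(c, r)`
(`r ≤ 2ρ_t`) from the tame Jordan domain `Ω = D.carrier` near the marked point `c`. This file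
proves that, for `ρ_t ≤ ρ_max(D)` and `δ ≤ δ₀(D)`, this never changes which component is the
largest away from `c`:

**Theorem** (`exists_params_meshDomain_diff`). Every point of `Ω_δ` at distance
`> r` from `c` belongs to `(Ω ∖ K)_δ`.

Proof: such a point is joined to the *core* (lattice points at distance `≥ ε` from `Ωᶜ`) in the
mesh graph of `Ω ∖ K` (`reach_core_of_walk`, part V), the core is connected there
(`core_reachable_diff`) and has `≥ area/δ²`-many points (`volume_real_le_ncard_mul`), whereas
every other component of the mesh graph of `Ω ∖ K` is either made of bulk points within `r` of
`c` or lies in a stray component of `Ω_δ`, of diameter `< ρ_max`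
(`JordanDomain.exists_mem_meshDomain_of_reachable`), hence has `O(ρ_max²/δ²)` points
(`ncard_lattice_closedBall_le`). Folklore; tree anchors as cited.
-/

noncomputable section

open Set Metric Complex MeasureTheory
open scoped ComplexConjugate
open Literature.Probability.LatticeModels
open Literature.Probability.RandomPlanarGeometry

namespace Summit.CriticalPhenomena.SAWScalingLimit.Theorems.ScreeningRecursion

/-! ## Counting lattice points in a ball -/

/-- **Lattice points in a ball.** The lattice points of `δℤ²` whose mesh points lie in the closed
ball `B̄(p, R)` number at most `(2R/δ + 5)²` (they project injectively into a square of
`(2⌈R/δ⌉ + 3)²` lattice sites around the site nearest to `p`). [folklore] -/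
theorem ncard_lattice_closedBall_le {δ : ℝ} (hδ : 0 < δ) (p : ℂ) {R : ℝ} (hR : 0 ≤ R) :
    (({y : Site 2 | dist (meshPoint δ y) p ≤ R}).ncard : ℝ) ≤ (2 * R / δ + 5) ^ 2 := by
  classical
  set S : Set (Site 2) := {y | dist (meshPoint δ y) p ≤ R} with hS
  set k : Site 2 := nearestSite δ p with hk
  have hkp : dist (meshPoint δ k) p ≤ δ := dist_meshPoint_nearestSite_le hδ p
  set N : ℕ := ⌈R / δ⌉₊ + 1 with hN
  have hNreal : (N : ℝ) ≤ R / δ + 2 := by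
    have := Nat.ceil_lt_add_one (show 0 ≤ R / δ by positivity)
    rw [hN]; push_cast; linarith
  have hNge : R / δ + 1 ≤ N := by
    rw [hN]; push_cast; linarith [Nat.le_ceil (R / δ)]
  -- coordinate bounds
  have hcoord : ∀ y ∈ S, ∀ j : Fin 2, |((y j : ℤ) : ℝ) - ((k j : ℤ) : ℝ)| ≤ N := by
    intro y hy j
    have h1 : ‖meshPoint δ y - meshPoint δ k‖ ≤ R + δ := by
      rw [← dist_eq_norm]
      calc dist (meshPoint δ y) (meshPoint δ k) ≤ dist (meshPoint δ y) p + dist p (meshPoint δ k) :=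
            dist_triangle _ _ _
        _ ≤ R + δ := by rw [dist_comm p]; exact add_le_add hy hkp
    have hre : (meshPoint δ y - meshPoint δ k).re = δ * (((y 0 : ℤ) : ℝ) - ((k 0 : ℤ) : ℝ)) := by
      simp only [Complex.sub_re, meshPoint_re]; ring
    have him : (meshPoint δ y - meshPoint δ k).im = δ * (((y 1 : ℤ) : ℝ) - ((k 1 : ℤ) : ℝ)) := by
      simp only [Complex.sub_im, meshPoint_im]; ring
    have h2 : δ * |((y j : ℤ) : ℝ) - ((k j : ℤ) : ℝ)| ≤ R + δ := by
      have hj : j = 0 ∨ j = 1 := by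
        rcases j with ⟨j, hj⟩
        interval_cases j
        · exact Or.inl rfl
        · exact Or.inr rfl
      rcases hj with rfl | rfl
      · have := abs_re_le_norm (meshPoint δ y - meshPoint δ k)
        rw [hre, abs_mul, abs_of_pos hδ] at this
        exact this.trans h1
      · have := abs_im_le_norm (meshPoint δ y - meshPoint δ k)
        rw [him, abs_mul, abs_of_pos hδ] at this
        exact this.trans h1
    have h3 : |((y j : ℤ) : ℝ) - ((k j : ℤ) : ℝ)| ≤ R / δ + 1 := by
      rw [show R / δ + 1 = (R + δ) / δ by field_simp, le_div_iff₀ hδ]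
      linarith
    exact h3.trans hNge
  -- injection into a square of sites
  have hcoordZ : ∀ y ∈ S, ∀ j : Fin 2, y j ∈ Finset.Icc (k j - N) (k j + N) := by
    intro y hy j
    have h := hcoord y hy j
    rw [abs_le] at h
    have h1 : ((k j : ℤ) : ℝ) - N ≤ (y j : ℝ) := by linarith [h.1]
    have h2 : ((y j : ℤ) : ℝ) ≤ (k j : ℝ) + N := by linarith [h.2]
    rw [Finset.mem_Icc]
    constructor
    · exact_mod_cast h1
    · exact_mod_cast h2
  set f : Site 2 → ℤ × ℤ := fun y => (y 0, y 1) with hf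
  have hfi : Function.Injective f := by
    intro y y' hy
    simp only [hf, Prod.mk.injEq] at hy
    funext l; fin_cases l
    · exact hy.1
    · exact hy.2
  set T : Finset (ℤ × ℤ) := (Finset.Icc (k 0 - N) (k 0 + N)) ×ˢ (Finset.Icc (k 1 - N) (k 1 + N))
    with hT
  have hle : S.ncard ≤ T.card := by
    rw [← Set.ncard_image_of_injective S hfi, ← Set.ncard_coe_finset]
    refine Set.ncard_le_ncard ?_ (Finset.finite_toSet _)
    rintro _ ⟨y, hy, rfl⟩
    simp only [hT, Finset.coe_product, mem_prod, Finset.mem_coe, hf]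
    exact ⟨hcoordZ y hy 0, hcoordZ y hy 1⟩
  have hTcard : (T.card : ℝ) = (2 * N + 1) ^ 2 := by
    rw [hT, Finset.card_product, Int.card_Icc, Int.card_Icc]
    have e : ∀ a : ℤ, (a + N + 1 - (a - N)).toNat = 2 * N + 1 := fun a => by omega
    rw [e, e]
    push_cast
    ring
  calc (S.ncard : ℝ) ≤ T.card := by exact_mod_cast hle
    _ = (2 * N + 1) ^ 2 := hTcard
    _ ≤ (2 * R / δ + 5) ^ 2 := by
        apply pow_le_pow_left₀ (by positivity)
        calc 2 * (N : ℝ) + 1 ≤ 2 * (R / δ + 2) + 1 := by linarith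
          _ = 2 * R / δ + 5 := by ring

/-! ## The bulk survives the removal of the near data -/

set_option maxHeartbeats 400000 in
/-- **The bulk survives the near data.** Let `D` be a Jordan domain, flat at `c` in direction
`u ≠ 0` up to radius `ρ₀ > 0`. There are `ρ_max > 0` and `δ₀ > 0` such that for all scales
`0 < ρ_t ≤ ρ_max`, meshes `0 < δ ≤ δ₀` with `δ ≤ ρ_t`, radii `0 ≤ r ≤ 2ρ_t` and near data
`K ⊆ B̄(c, r)`: every point of `Ω_δ = meshDomain D.carrier δ` at distance `> r` from `c` lies
in `(Ω ∖ K)_δ = meshDomain (D.carrier ∖ K) δ`. See the module docstring for the proof.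
[folklore] -/
theorem exists_params_meshDomain_diff
    (D : JordanDomain) {c u : ℂ} {ρ₀ : ℝ} (hρ₀ : 0 < ρ₀) (hu : u ≠ 0)
    (hflat : D.carrier ∩ ball c ρ₀ = {z | 0 < ((z - c) * u).im} ∩ ball c ρ₀) :
    ∃ ρmax > 0, ∃ δ₀ > 0, ∀ ρt δ r : ℝ, 0 < ρt → ρt ≤ ρmax → 0 < δ → δ ≤ δ₀ → δ ≤ ρt →
      0 ≤ r → r ≤ 2 * ρt → ∀ K : Set ℂ, K ⊆ closedBall c r →
        ∀ x ∈ meshDomain D.carrier δ, r < dist (meshPoint δ x) c →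
          x ∈ meshDomain (D.carrier \ K) δ := by
  classical
  set Ω := D.carrier with hΩ_def
  have hΩo : IsOpen Ω := D.isOpen
  have hΩb : Bornology.IsBounded Ω := D.isBounded
  have hΩc : IsConnected Ω := D.isConnected
  have hΩne : Ω.Nonempty := hΩc.nonempty
  have hΩuniv : Ω ≠ univ := fun h => NormedSpace.unbounded_univ ℝ ℂ (h ▸ hΩb)
  have hne : Ωᶜ.Nonempty := nonempty_compl.2 hΩuniv
  have hcΩ : c ∈ Ωᶜ := center_not_mem_of_flat hflat hρ₀
  set v : ℝ := volume.real (ball (0 : ℂ) 1) with hv_def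
  have hv : 0 < v :=
    ENNReal.toReal_pos (measure_ball_pos volume (0 : ℂ) one_pos).ne' measure_ball_lt_top.ne
  set m : ℝ := volume.real Ω with hm_def
  have hm : 0 < m := ENNReal.toReal_pos (hΩo.measure_pos volume hΩne).ne' hΩb.measure_lt_top.ne
  -- Step A: the core depth `ε`
  obtain ⟨r₁, hr₁, hcollar⟩ := exists_pos_volume_real_innerCollar_lt hΩo hΩb hne (by positivity : 0 < m / 2)
  set ε : ℝ := min (r₁ / 2) (ρ₀ / 6) with hε_def
  have hε : 0 < ε := by positivity
  have hεr₁ : 2 * ε ≤ r₁ := by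
    have := min_le_left (r₁ / 2) (ρ₀ / 6); rw [← hε_def] at this; linarith
  have hερ₀ : ε ≤ ρ₀ / 6 := min_le_right _ _
  set A : ℝ := volume.real {z ∈ Ω | 2 * ε ≤ infDist z Ωᶜ} with hA_def
  have hA : m / 2 ≤ A := by
    have hTmono : volume.real {z ∈ Ω | infDist z Ωᶜ < 2 * ε} ≤
        volume.real {z ∈ Ω | infDist z Ωᶜ < r₁} :=
      measureReal_mono (fun z hz => ⟨hz.1, hz.2.trans_le hεr₁⟩)
        (hΩb.subset fun z hz => hz.1).measure_lt_top.ne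
    have hsplit : m ≤ A + volume.real {z ∈ Ω | infDist z Ωᶜ < 2 * ε} := by
      have hcov : Ω ⊆ {z ∈ Ω | 2 * ε ≤ infDist z Ωᶜ} ∪ {z ∈ Ω | infDist z Ωᶜ < 2 * ε} := by
        intro z hz
        rcases le_or_gt (2 * ε) (infDist z Ωᶜ) with h | h
        · exact Or.inl ⟨hz, h⟩
        · exact Or.inr ⟨hz, h⟩
      calc m ≤ volume.real ({z ∈ Ω | 2 * ε ≤ infDist z Ωᶜ} ∪ {z ∈ Ω | infDist z Ωᶜ < 2 * ε}) :=
            measureReal_mono hcov ((hΩb.subset (union_subset (fun z hz => hz.1)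
              (fun z hz => hz.1))).measure_lt_top.ne)
        _ ≤ _ := measureReal_union_le _ _
    linarith
  have hApos : 0 < A := by linarith
  -- Step B: the bulk neighbourhood of the core
  obtain ⟨hKc, hKΩ⟩ := D.isCompact_setOf_le_infDist_compl hε
  obtain ⟨V, -, hVc, hKV, -, ρV, hρV, hVρ⟩ := exists_isOpen_isPreconnected_bulk hΩo hΩc hne hKc hKΩ
  -- Step C: the tree thresholds
  obtain ⟨δ₂, hδ₂, hbulk⟩ := D.exists_forall_mem_meshDomain_and_reachable hKc hKΩ
  -- the scale bound `ρ_max`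
  set ρmax : ℝ := min (min 1 (A / (82 * v))) (min (min (ρ₀ / 18) (ε / 3)) (ρV / 5)) with hρmax_def
  have hρmax : 0 < ρmax := by positivity
  have hρmax1 : ρmax ≤ 1 := (min_le_left _ _).trans (min_le_left _ _)
  have hρmaxA : ρmax ≤ A / (82 * v) := (min_le_left _ _).trans (min_le_right _ _)
  have hρmaxρ₀ : ρmax ≤ ρ₀ / 18 := (min_le_right _ _).trans ((min_le_left _ _).trans (min_le_left _ _))
  have hρmaxε : ρmax ≤ ε / 3 := (min_le_right _ _).trans ((min_le_left _ _).trans (min_le_right _ _))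
  have hρmaxV : ρmax ≤ ρV / 5 := (min_le_right _ _).trans (min_le_right _ _)
  have hρmax2 : 81 * ρmax ^ 2 < A / v := by
    have h1 : ρmax ^ 2 ≤ ρmax := by nlinarith
    have h2 : 82 * ρmax ≤ A / v := by
      rw [le_div_iff₀ hv]; rw [le_div_iff₀ (by positivity)] at hρmaxA; linarith
    nlinarith [hApos, div_pos hApos hv]
  obtain ⟨δ₁, hδ₁, hstray⟩ := D.exists_mem_meshDomain_of_reachable hρmax
  -- the mesh bound `δ₀`
  set δ₀ : ℝ := min (min (δ₁ / 2) (δ₂ / 2)) (min ε (ρV / 6)) with hδ₀_def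
  have hδ₀ : 0 < δ₀ := by positivity
  refine ⟨ρmax, hρmax, δ₀, hδ₀, ?_⟩
  intro ρt δ r hρt hρtmax hδ hδδ₀ hδρt hr0 hrρt K hK x hx hxfar
  have hδδ₁ : δ < δ₁ := by
    have := hδδ₀.trans ((min_le_left _ _).trans (min_le_left _ _)); linarith
  have hδδ₂ : δ < δ₂ := by
    have := hδδ₀.trans ((min_le_left _ _).trans (min_le_right _ _)); linarith
  have hδε : δ ≤ ε := hδδ₀.trans ((min_le_right _ _).trans (min_le_left _ _))
  have hδV : 6 * δ ≤ ρV := by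
    have := hδδ₀.trans ((min_le_right _ _).trans (min_le_right _ _)); linarith
  have hδρmax : δ ≤ ρmax := hδρt.trans hρtmax
  -- hypotheses of the escape lemmas
  have hgeom : 6 * ρt + 3 * δ + 3 * ε ≤ ρ₀ := by nlinarith
  have hρtε : 2 * ρt < ε := by linarith
  have hrV : r < ρV / 2 := by linarith
  have hrε : r < ε := by linarith
  -- the core lattice points and their count
  set P : Set (Site 2) := {y | meshPoint δ y ∈ Ω ∧ ε ≤ infDist (meshPoint δ y) Ωᶜ} with hP_def
  have hPcount : A ≤ (P.ncard : ℝ) * (δ ^ 2 * v) := volume_real_le_ncard_mul hΩb hδ hδε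
  have hPpos : 0 < P.ncard := by
    by_contra h0
    push Not at h0
    have : (P.ncard : ℝ) = 0 := by exact_mod_cast Nat.le_zero.1 h0
    rw [this, zero_mul] at hPcount
    linarith
  obtain ⟨y₀, hy₀⟩ : P.Nonempty := nonempty_of_ncard_ne_zero (by omega)
  -- the tree's description of `Ω_δ`: contains the core, single component
  obtain ⟨hbulk1, hbulk2⟩ := hbulk δ hδ hδδ₂
  have hy₀dom : y₀ ∈ meshDomain Ω δ := hbulk1 y₀ hy₀.2
  -- `x` reaches a core point in the mesh graph of `Ω ∖ K`
  obtain ⟨hxv, hy₀v, hxy₀⟩ := hbulk2 x hx y₀ hy₀dom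
  obtain ⟨z, hz, hx', hzv, hxz⟩ := reach_core_of_walk hflat hu hne hK hr0 hrρt hδ hδρt hε hgeom hρtε
    hxy₀.some hy₀.2 hxfar
  -- abbreviations for the graph of `Ω ∖ K`
  set G := meshVertexGraph (Ω \ K) δ with hG_def
  set Cx : G.ConnectedComponent := G.connectedComponentMk ⟨x, hx'⟩ with hCx_def
  have hfinV : (meshVertices (Ω \ K) δ).Finite := meshVertices_finite (hΩb.subset Set.sdiff_subset) hδ
  have hfin_img : ∀ C : G.ConnectedComponent, (Subtype.val '' C.supp).Finite := fun C =>
    hfinV.subset (by rintro _ ⟨w, -, rfl⟩; exact w.2)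
  -- every core lattice point is in `Cx`
  have hcore_mem : ∀ w : Site 2, meshPoint δ w ∈ V →
      ∃ hw : w ∈ meshVertices (Ω \ K) δ, G.connectedComponentMk ⟨w, hw⟩ = Cx := by
    intro w hw
    have hzV : meshPoint δ z ∈ V := hKV hz
    obtain ⟨hw', hz', hwz⟩ := core_reachable_diff hδ hδV hVc hVρ hcΩ hK hrV hw hzV
    refine ⟨hw', ?_⟩
    rw [hCx_def]
    exact SimpleGraph.ConnectedComponent.sound (hwz.trans hxz.symm)
  -- lower bound on `|Cx|`
  have hPsub : P ⊆ Subtype.val '' Cx.supp := by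
    intro w hw
    obtain ⟨hw', hwC⟩ := hcore_mem w (hKV hw.2)
    exact ⟨⟨w, hw'⟩, (SimpleGraph.ConnectedComponent.mem_supp_iff _ _).2 hwC, rfl⟩
  have hCx_low : A / (δ ^ 2 * v) ≤ ((Subtype.val '' Cx.supp).ncard : ℝ) := by
    rw [div_le_iff₀ (by positivity)]
    refine hPcount.trans ?_
    have : (P.ncard : ℝ) ≤ ((Subtype.val '' Cx.supp).ncard : ℝ) := by
      exact_mod_cast Set.ncard_le_ncard hPsub (hfin_img Cx)
    exact mul_le_mul_of_nonneg_right this (by positivity)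
  -- upper bound on every other component
  have hother : ∀ C : G.ConnectedComponent, C ≠ Cx →
      ((Subtype.val '' C.supp).ncard : ℝ) ≤ 81 * ρmax ^ 2 / δ ^ 2 := by
    intro C hC
    obtain ⟨w, hwC⟩ := C.nonempty_supp
    rw [SimpleGraph.ConnectedComponent.mem_supp_iff] at hwC
    -- any member of `C` is joined to `w` in the mesh graph of `Ω`
    have hjoin : ∀ w' ∈ C.supp, (meshVertexGraph Ω δ).Reachable ⟨w.1, w.2.1⟩ ⟨w'.1, w'.2.1⟩ := by
      intro w' hw'
      rw [SimpleGraph.ConnectedComponent.mem_supp_iff] at hw'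
      have h := SimpleGraph.ConnectedComponent.exact (hwC.trans hw'.symm)
      exact reachable_mono_domain Set.sdiff_subset w.2 w'.2 h
    -- no member of `C` is a far bulk point (else it would be in `Cx`)
    have hnotfar : ∀ w' ∈ C.supp, w'.1 ∈ meshDomain Ω δ → dist (meshPoint δ w'.1) c ≤ r := by
      intro w' hw' hdom
      by_contra hfar
      push Not at hfar
      obtain ⟨hv1, hy1, hw'y₀⟩ := hbulk2 w'.1 hdom y₀ hy₀dom
      obtain ⟨z', hz', hw'', hz'v, hw'z'⟩ := reach_core_of_walk hflat hu hne hK hr0 hrρt hδ hδρt hε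
        hgeom hρtε hw'y₀.some hy₀.2 hfar
      obtain ⟨_, hz'C⟩ := hcore_mem z' (hKV hz')
      rw [SimpleGraph.ConnectedComponent.mem_supp_iff] at hw'
      apply hC
      rw [← hw', ← hz'C]
      exact SimpleGraph.ConnectedComponent.sound hw'z'
    by_cases hwdom : w.1 ∈ meshDomain Ω δ
    · -- case (a): a bulk component near `c`
      have hsub : Subtype.val '' C.supp ⊆ {y | dist (meshPoint δ y) c ≤ r} := by
        rintro _ ⟨w', hw', rfl⟩
        have hdom' : w'.1 ∈ meshDomain Ω δ :=
          mem_meshDomain_of_reachable_meshVertexGraph hwdom w.2.1 w'.2.1 (hjoin w' hw')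
        exact hnotfar w' hw' hdom'
      calc ((Subtype.val '' C.supp).ncard : ℝ) ≤ ({y : Site 2 | dist (meshPoint δ y) c ≤ r}.ncard : ℝ) := by
            have hfin : ({y : Site 2 | dist (meshPoint δ y) c ≤ r}).Finite := by
              refine (meshVertices_finite (isBounded_closedBall (x := c) (r := r)) hδ).subset ?_
              intro y hy; exact mem_closedBall.2 hy
            exact_mod_cast Set.ncard_le_ncard hsub hfin
        _ ≤ (2 * r / δ + 5) ^ 2 := ncard_lattice_closedBall_le hδ c hr0
        _ ≤ 81 * ρmax ^ 2 / δ ^ 2 := by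
            rw [div_add' _ _ _ hδ.ne', div_pow, div_le_div_iff_of_pos_right (by positivity)]
            have : 2 * r + 5 * δ ≤ 9 * ρmax := by linarith
            exact pow_le_pow_left₀ (by positivity) this 2 |>.trans (by nlinarith)
    · -- case (b): a stray component
      have hsub : Subtype.val '' C.supp ⊆ {y | dist (meshPoint δ y) (meshPoint δ w.1) ≤ ρmax} := by
        rintro _ ⟨w', hw', rfl⟩
        show dist (meshPoint δ w'.1) (meshPoint δ w.1) ≤ ρmax
        by_contra hlt
        push Not at hlt
        exact hwdom (hstray δ hδ hδδ₁ ⟨w.1, w.2.1⟩ ⟨w'.1, w'.2.1⟩ (hjoin w' hw')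
          (by rw [dist_comm]; exact hlt.le))
      calc ((Subtype.val '' C.supp).ncard : ℝ)
          ≤ ({y : Site 2 | dist (meshPoint δ y) (meshPoint δ w.1) ≤ ρmax}.ncard : ℝ) := by
            have hfin : ({y : Site 2 | dist (meshPoint δ y) (meshPoint δ w.1) ≤ ρmax}).Finite := by
              refine (meshVertices_finite (isBounded_closedBall (x := meshPoint δ w.1) (r := ρmax))
                hδ).subset ?_
              intro y hy; exact mem_closedBall.2 hy
            exact_mod_cast Set.ncard_le_ncard hsub hfin
        _ ≤ (2 * ρmax / δ + 5) ^ 2 := ncard_lattice_closedBall_le hδ _ hρmax.le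
        _ ≤ 81 * ρmax ^ 2 / δ ^ 2 := by
            rw [div_add' _ _ _ hδ.ne', div_pow, div_le_div_iff_of_pos_right (by positivity)]
            have : 2 * ρmax + 5 * δ ≤ 9 * ρmax := by linarith
            exact pow_le_pow_left₀ (by positivity) this 2 |>.trans (by nlinarith)
  -- so `Cx` is a component of maximal cardinality
  have hmax : ∀ C : G.ConnectedComponent, C.supp.ncard ≤ Cx.supp.ncard := by
    intro C
    by_cases hC : C = Cx
    · rw [hC]
    · have h1 := hother C hC
      have h2 : 81 * ρmax ^ 2 / δ ^ 2 < A / (δ ^ 2 * v) := by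
        rw [show A / (δ ^ 2 * v) = (A / v) / δ ^ 2 by field_simp]
        exact div_lt_div_of_pos_right hρmax2 (by positivity)
      have h3 : ((Subtype.val '' C.supp).ncard : ℝ) ≤ ((Subtype.val '' Cx.supp).ncard : ℝ) := by
        linarith
      rw [Set.ncard_image_of_injective _ Subtype.val_injective,
        Set.ncard_image_of_injective _ Subtype.val_injective] at h3
      exact_mod_cast h3
  -- conclude
  simp only [meshDomain, mem_iUnion, mem_image]
  exact ⟨Cx, hmax, ⟨x, hx'⟩, (SimpleGraph.ConnectedComponent.mem_supp_iff _ _).2 rfl, rfl⟩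

end Summit.CriticalPhenomena.SAWScalingLimit.Theorems.ScreeningRecursion

end
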